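import HarnessLib
import HarnessLib.Audit
import Summits.PneNP.PneNP.Theses.StraightLineSign
import Literature.Computability.AlgebraicComplexity.PosSLP
import Literature.Computability.Complexity.Reductions
import Literature.Computability.Complexity.ReductionsProofs

/-!
# Line `birth` — skeleton for the crux `PosSLPNotInP` (stmt-PneNP-18283)

Route `StraightLineSign` (route-PneNP-StraightLineSign), crux (rank 3) `PosSLPNotInP` =
`posSLP ∉ P`: the language of `encodingListNatBool`-codes of flattened division-free straight-line
programs over `{1; +, −, ×}` with positive value (Allender–Bürgisser–Kjeldgaard-Pedersen–Miltersen,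
SIAM J. Comput. 38 (2009), §2 "PosSLP") is decided by no deterministic polynomial-time Turing machine.
Definitionally `PosSLPNotInP ↔ Literature.Computability.AlgebraicComplexity.posSLP ∉ Classes.P`
(`Iff.rfl`; grounder g78-10, refuter rattack-stmt-PneNP-18283-0).

THE LINE = the route header's own TWO-LAYER PLAN for this crux ("PosSLPNotInP ⇐
DegSLPKarpReducesToPosSLP (AllenderEtAl2009 Prop 2.3, printed theorem) → DegSLPNotInP → PosSLPNotInP, the
algebraic rung: degree = cancellation of leading coefficients of an SLP-computed polynomial"), made to
elaborate in the UNIVARIATE form the printed proof actually uses (ABKM p. 10: "The problem DegSLP is not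
known to lie in BPP, even for the special case of univariate polynomials. Here, we show that it reduces to
PosSLP"; Prop 2.3: "DegSLP polynomial time many-one reduces to PosSLP"; proof: univariate case first, then
`f*(X₁,…,X_m,Y) = f(X₁Y,…,X_mY)` reduces multivariate to univariate). Objects (all INLINED with `let`, over
Mathlib + Literature declarations only, so every stub can be restated verbatim in a `Theorems/` file):

* `upoly prog : ℤ[X]` — the polynomial of a flattened univariate program: value list starts `[1, X]`;
  instruction `(op, j, k)` appends `v_j ∘ v_k`, `∘ = +, −, ×` for `op % 3 = 0, 1, 2`; out-of-range operands
  read `0`; the value is the last entry (the same conventions as `slpStep`/`slpValue`/`posSLP`).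
* `uniDegSLP : Language Bool` — codes of lists `d :: [op₁, j₁, k₁, op₂, …]` (so `d` is in BINARY, as in
  ABKM: `encodingListNatBool = encodingNatBool.listBool`, `encodeNat`) with `natDegree (upoly prog) ≤ d`.

Stubs (the ONLY `sorry`s of the file; 3 sorries = 3 stubs):

* `stub_uslpGrowthBound` (ABKM p. 9, "an easy induction in the size of the straight line program";
  size S–M, PROVABLE NOW): after `n` instructions, `natDegree ≤ 2^n` and `ℓ¹`-norm `Σ|coeff| ≤ 2^(2^n)`
  (`1, X` have degree ≤ 1 = 2^0 and norm 1; `±` at most doubles the norm, `×` at most squares it and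
  adds degrees; `2·2^(2^n) ≤ 2^(2^(n+1))`).
* `stub_uniDegSLP_karpReducible_posSLP` (ABKM Prop 2.3, univariate case; size L, PROVABLE NOW, machine
  level): the growth bound ⟹ `uniDegSLP ≤ₚ posSLP`. Printed mechanism: with `B = 2^(2^n + 2) ≥ 4·Σ|coeff f|`
  (`n + 3` instructions: `2 = 1 + 1`, `n` squarings, `× 4`) one has, for `f ≠ 0` of degree `e`,
  `B^e/2 < (3/4)·B^e ≤ |f(B)| ≤ Σ|coeff f|·B^e ≤ B^(e+1)/4`, hence `deg f ≤ d ↔ B^(2(d+1)) − 4·f(B)² > 0`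
  (also for `f = 0`); the map `code(d :: prog) ↦ code(prog')`, `prog'` = [program for `B`; `prog` with
  operand `1 ↦` index of `B` and later indices shifted; square-and-multiply for `B^(d+1)` along the binary
  digits of `d + 1`; the final difference], non-codes ↦ the code of `[(1,0,0)]` (value `1 − 1 = 0 ∉ posSLP`),
  is polynomial-time (`FP`) — ABKM's own variant uses `f₁ = (X·f + 1)²` and tests `2·f₁(B_n) − B_n^(D+1) > 0`.
* `stub_uniDegSLP_not_mem_P` (OPEN; size = open problem; LOAD-BEARING): `uniDegSLP ∉ P`. HONESTY RECORD
  (refuter rattack-stmt-PneNP-18283-0, CRUX-ATTACK.md, and this registrar): with Stubs 1–2 this stub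
  IMPLIES the crux, so it is AT LEAST AS STRONG as the crux — every transfer-by-reduction skeleton of a lower
  bound has this shape (`X ≤ₚ posSLP ∧ X ∉ P`, hence `X ∉ P ⟹ posSLP ∉ P`); the line RELOCATES the
  difficulty to a problem with more algebraic structure (membership = vanishing of ALL coefficients above
  `d`, i.e. an identity test of a truncation at exponential order; `ACIT ≤ₚ DegSLP`, ABKM Prop 2.2/§2 chain
  `ACIT ≤ DegSLP ≤ PosSLP ≤ BitSLP`), it does not lower it. No unconditional lower bound for DegSLP is in
  print either; it is consistent with the route's other crux `PosSLPInPH` (under it `uniDegSLP ∈ PH`, and then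
  this stub, like the crux itself, implies `P ≠ PH`, i.e. the summit — the squeeze is inherent to the route,
  not to this line). The converse `crux → stub 3` is NOT claimed (PosSLP could be hard with DegSLP easy):
  the split is an implication, not an equivalence. Necessary floor (kernel-checked by the refuter,
  PosSLPNotInP_sanity.lean `PP_ne_P_of_crux`): crux ∧ `AllenderEtAl2009_posSLP_mem_CH` ⟹ `PP ≠ P`.
* composition (sorry-free): `posSLP_not_mem_P_of_sigs` (explicit hypotheses = the three stub statements,
  conclusion = the crux's unfolded form `posSLP ∉ P`; proof: `P` is closed downward under `≤ₚ`, tree theorem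
  `mem_P_of_karpReducible_holds`) and THE SKELETON THEOREM `PosSLPNotInP_of : PosSLPNotInP` (crux BY NAME —
  `PosSLPNotInP` is `posSLP ∉ P` by `rfl`; the file's only theorem headed by the crux; axioms =
  propext/Classical.choice/Quot.sound + `sorryAx` from the three stubs only).

Alternatives considered and NOT registered (registrar census, 2026-08-17): (i) the necessary-piece split
`(PP ≠ P) ∧ (posSLP ∈ P → PP ⊆ P)` — both pieces open and each weaker than the crux, but the second piece's
only non-vacuous proof route is PP-type hardness of PosSLP, which together with the route's crux `PosSLPInPH`
collapses PH (route kill criterion) — a line at war with its own route; (ii) the Blum–Shub–Smale reading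
`P^PosSLP = BP(P⁰_ℝ)` (ABKM Prop 1.1) — no real machines in the tree, not typable today; (iii) NP-, coNP- or Σₖ-hardness
plus a class separation — circular (the separation is the summit); (iv) Bürgisser–Jindal's RadConj
reduction (arXiv:2307.08008 Thm 1.2) — derives the crux FROM `NP ⊄ BPP`, unusable toward the summit (route
header, NOT DECOMPOSED YET).

Disproof used: none exists for this crux (`ledger crux ls stmt-PneNP-18283`: no workfiles, no Disproof.lean,
no crux ideas, 2026-08-17T13:40Z). Negatives honoured: `ledger negatives --problem PneNP` (5 statements:
Lyapunov/PHP, BavardGap planted genus, magnification frontier, OR-incompressibility, TwoTones) — none concerns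
straight-line programs, PosSLP/DegSLP or Karp closure; no stub is an instance of a refuted statement.
BC3 probes (seat folder `bc/probe_stub{1,2,3}.lean`): `stub → PosSLPNotInP` and `stub → PneNP` by
`first | exact? | simpa using h | simpa [PosSLPNotInP] using h | aesop` FAIL for all three stubs (outputs in
the seat's NOTES.md and in `Lines/birth.md`). Planner planner-skel-stmt-PneNP-18283-0, 2026-08-17.
-/

set_option linter.dupNamespace false
set_option linter.unusedVariables false

namespace Summit.PneNP.PneNP.Cruxes.PosSLPNotInP.Birth

open Literature.Computability.Complexity
open Literature.Computability.AlgebraicComplexity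
open scoped Literature.Computability.Complexity.Notation

/-! ## §1 Registered stubs -/

/-- **Stub 1 — growth bound for univariate straight-line programs** (ABKM 2009, proof of Prop 2.2,
p. 9: "An easy induction in the size of the straight line program shows that |αᵢ| ≤ 2^(2^(2n)) … and that
the degree … is at most 2^n"; here in the sharper ℓ¹ form the univariate reduction needs). For a flattened
univariate program with `n` instructions (value list from `[1, X]`, `(op,j,k)` appends `v_j ∘ v_k`,
out-of-range reads `0`), the computed polynomial has `natDegree ≤ 2^n` and `Σᵢ |coeffᵢ| ≤ 2^(2^n)`.
Size S–M; provable now (induction over `List.foldl`, strengthened to every entry of the value list).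
[cite: AllenderEtAl2009, §2 (proof of Prop. 2.2, coefficient and degree bounds)] -/
theorem stub_uslpGrowthBound :
    let ustep : List (Polynomial ℤ) → ℕ × ℕ × ℕ → List (Polynomial ℤ) := fun vs ins => vs ++ [if ins.1 % 3 = 0 then vs.getD ins.2.1 0 + vs.getD ins.2.2 0 else if ins.1 % 3 = 1 then vs.getD ins.2.1 0 - vs.getD ins.2.2 0 else vs.getD ins.2.1 0 * vs.getD ins.2.2 0]; let upoly : List (ℕ × ℕ × ℕ) → Polynomial ℤ := fun prog => ((prog.foldl ustep [1, Polynomial.X]).getLast?).getD 0; ∀ prog : List (ℕ × ℕ × ℕ), (upoly prog).natDegree ≤ 2 ^ prog.length ∧ (∑ i ∈ (upoly prog).support, |(upoly prog).coeff i|) ≤ (2 : ℤ) ^ (2 ^ prog.length) := by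
  sorry

/-- **Stub 2 — univariate DegSLP Karp-reduces to PosSLP** (ABKM 2009, Prop 2.3: "DegSLP polynomial
time many-one reduces to PosSLP", univariate case of the printed proof, pp. 10–11), stated over the growth
bound of Stub 1: evaluate at `B = 2^(2^n+2)` and test `B^(2(d+1)) − 4·f(B)² > 0` (equivalently ABKM's
`2·f₁(B_n) − B_n^(D+1) > 0` with `f₁ = (X f + 1)²`); the code map `d :: prog ↦ prog'` (re-index operand
`X ↦ B`, square-and-multiply for `B^(d+1)`, final difference; non-codes ↦ a fixed program of value `0`) is in
`FP`. Size L (machine level, `Turing.FinTM2` via the tree's `FP`/`PolyTimeComputable` combinators); provable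
now. [cite: AllenderEtAl2009, Prop. 2.3] -/
theorem stub_uniDegSLP_karpReducible_posSLP :
    (let ustep : List (Polynomial ℤ) → ℕ × ℕ × ℕ → List (Polynomial ℤ) := fun vs ins => vs ++ [if ins.1 % 3 = 0 then vs.getD ins.2.1 0 + vs.getD ins.2.2 0 else if ins.1 % 3 = 1 then vs.getD ins.2.1 0 - vs.getD ins.2.2 0 else vs.getD ins.2.1 0 * vs.getD ins.2.2 0]; let upoly : List (ℕ × ℕ × ℕ) → Polynomial ℤ := fun prog => ((prog.foldl ustep [1, Polynomial.X]).getLast?).getD 0; ∀ prog : List (ℕ × ℕ × ℕ), (upoly prog).natDegree ≤ 2 ^ prog.length ∧ (∑ i ∈ (upoly prog).support, |(upoly prog).coeff i|) ≤ (2 : ℤ) ^ (2 ^ prog.length)) → (let ustep : List (Polynomial ℤ) → ℕ × ℕ × ℕ → List (Polynomial ℤ) := fun vs ins => vs ++ [if ins.1 % 3 = 0 then vs.getD ins.2.1 0 + vs.getD ins.2.2 0 else if ins.1 % 3 = 1 then vs.getD ins.2.1 0 - vs.getD ins.2.2 0 else vs.getD ins.2.1 0 * vs.getD ins.2.2 0];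 let upoly : List (ℕ × ℕ × ℕ) → Polynomial ℤ := fun prog => ((prog.foldl ustep [1, Polynomial.X]).getLast?).getD 0; let uniDegSLP : Language Bool := Literature.Computability.Complexity.encodingListNatBool.toLanguage {l : List ℕ | ∃ (d : ℕ) (prog : List (ℕ × ℕ × ℕ)), l = d :: prog.flatMap (fun ins => [ins.1, ins.2.1, ins.2.2]) ∧ (upoly prog).natDegree ≤ d}; Literature.Computability.Complexity.PolyTimeKarpReducible uniDegSLP Literature.Computability.AlgebraicComplexity.posSLP) := by
  sorry

/-- **Stub 3 — univariate DegSLP is not in P** (OPEN; LOAD-BEARING). ABKM 2009, p. 10: "The problem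
DegSLP is not known to lie in BPP, even for the special case of univariate polynomials"; no lower bound is in
print. HONESTY RECORD: with Stubs 1–2 this statement implies the crux `PosSLPNotInP`, so it is at least as
strong as the crux (a transfer RELOCATES the difficulty to the degree problem — membership = vanishing of all
coefficients above `d` — it does not lower it; refuter rattack-stmt-PneNP-18283-0). Not implied by the crux.
Under the route's companion crux `PosSLPInPH` it lies in `PH ∖ P`, exactly like the crux.
[cite: AllenderEtAl2009, §2 (DegSLP; remark before Prop. 2.3)] -/
theorem stub_uniDegSLP_not_mem_P :
    let ustep : List (Polynomial ℤ) → ℕ × ℕ × ℕ → List (Polynomial ℤ) := fun vs ins => vs ++ [if ins.1 % 3 = 0 then vs.getD ins.2.1 0 + vs.getD ins.2.2 0 else if ins.1 % 3 = 1 then vs.getD ins.2.1 0 - vs.getD ins.2.2 0 else vs.getD ins.2.1 0 * vs.getD ins.2.2 0]; let upoly : List (ℕ × ℕ × ℕ) → Polynomial ℤ := fun prog => ((prog.foldl ustep [1, Polynomial.X]).getLast?).getD 0; let uniDegSLP : Language Bool := Literature.Computability.Complexity.encodingListNatBool.toLanguage {l : List ℕ | ∃ (d : ℕ) (prog : List (ℕ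 × ℕ × ℕ)), l = d :: prog.flatMap (fun ins => [ins.1, ins.2.1, ins.2.2]) ∧ (upoly prog).natDegree ≤ d}; uniDegSLP ∉ Literature.Computability.Complexity.Classes.P := by
  sorry

/-! ## §2 The composition (sorry-free) -/

/-- **Composition with explicit hypotheses** (BC3 shape `growth-bound → reduction → hardness → crux`): `P` is
closed downward under Karp reductions (tree theorem `mem_P_of_karpReducible_holds`, Arora–Barak Thm 2.8(2)).
The conclusion is the crux's UNFOLDED form `posSLP ∉ P` — definitionally the crux (`crux_iff_posSLP_not_mem_P`
below is `Iff.rfl`) — stated unfolded on purpose so that `PosSLPNotInP_of` is the file's ONLY theorem headed by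
the crux name (what `ledger skeleton check` keys on: its skeleton theorem may take no hypotheses other than
registered obligations by name). The `let`-telescopes of the hypotheses are seen through by zeta-unfolding.
[cite: AroraBarakCC2009, Thm. 2.8(2)] -/
theorem posSLP_not_mem_P_of_sigs
    (hB : let ustep : List (Polynomial ℤ) → ℕ × ℕ × ℕ → List (Polynomial ℤ) := fun vs ins => vs ++ [if ins.1 % 3 = 0 then vs.getD ins.2.1 0 + vs.getD ins.2.2 0 else if ins.1 % 3 = 1 then vs.getD ins.2.1 0 - vs.getD ins.2.2 0 else vs.getD ins.2.1 0 * vs.getD ins.2.2 0]; let upoly : List (ℕ × ℕ × ℕ) → Polynomial ℤ := fun prog => ((prog.foldl ustep [1, Polynomial.X]).getLast?).getD 0; ∀ prog : List (ℕ × ℕ × ℕ), (upoly prog).natDegree ≤ 2 ^ prog.length ∧ (∑ i ∈ (upoly prog).support, |(upoly prog).coeff i|) ≤ (2 : ℤ) ^ (2 ^ prog.length))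
    (hR : (let ustep : List (Polynomial ℤ) → ℕ × ℕ × ℕ → List (Polynomial ℤ) := fun vs ins => vs ++ [if ins.1 % 3 = 0 then vs.getD ins.2.1 0 + vs.getD ins.2.2 0 else if ins.1 % 3 = 1 then vs.getD ins.2.1 0 - vs.getD ins.2.2 0 else vs.getD ins.2.1 0 * vs.getD ins.2.2 0]; let upoly : List (ℕ × ℕ × ℕ) → Polynomial ℤ := fun prog => ((prog.foldl ustep [1, Polynomial.X]).getLast?).getD 0; ∀ prog : List (ℕ × ℕ × ℕ), (upoly prog).natDegree ≤ 2 ^ prog.length ∧ (∑ i ∈ (upoly prog).support, |(upoly prog).coeff i|) ≤ (2 : ℤ) ^ (2 ^ prog.length)) → (let ustep : List (Polynomial ℤ) → ℕ × ℕ × ℕ → List (Polynomial ℤ) := fun vs ins => vs ++ [if ins.1 % 3 = 0 then vs.getD ins.2.1 0 + vs.getD ins.2.2 0 else if ins.1 % 3 = 1 then vs.getD ins.2.1 0 - vs.getD ins.2.2 0 else vs.getD ins.2.1 0 * vs.getD ins.2.2 0]; let upoly : List (ℕ × ℕ × ℕ) → Polynomial ℤ := fun prog => ((prog.foldl ustep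 [1, Polynomial.X]).getLast?).getD 0; let uniDegSLP : Language Bool := Literature.Computability.Complexity.encodingListNatBool.toLanguage {l : List ℕ | ∃ (d : ℕ) (prog : List (ℕ × ℕ × ℕ)), l = d :: prog.flatMap (fun ins => [ins.1, ins.2.1, ins.2.2]) ∧ (upoly prog).natDegree ≤ d}; Literature.Computability.Complexity.PolyTimeKarpReducible uniDegSLP Literature.Computability.AlgebraicComplexity.posSLP))
    (hH : let ustep : List (Polynomial ℤ) → ℕ × ℕ × ℕ → List (Polynomial ℤ) := fun vs ins => vs ++ [if ins.1 % 3 = 0 then vs.getD ins.2.1 0 + vs.getD ins.2.2 0 else if ins.1 % 3 = 1 then vs.getD ins.2.1 0 - vs.getD ins.2.2 0 else vs.getD ins.2.1 0 * vs.getD ins.2.2 0]; let upoly : List (ℕ × ℕ × ℕ) → Polynomial ℤ := fun prog => ((prog.foldl ustep [1, Polynomial.X]).getLast?).getD 0; let uniDegSLP : Language Bool := Literature.Computability.Complexity.encodingListNatBool.toLanguage {l : List ℕ | ∃ (d : ℕ) (prog : List (ℕ × ℕ × ℕ)), l = d :: prog.flatMap (fun ins => [ins.1, ins.2.1, ins.2.2])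 ∧ (upoly prog).natDegree ≤ d}; uniDegSLP ∉ Literature.Computability.Complexity.Classes.P) :
    Literature.Computability.AlgebraicComplexity.posSLP ∉ Literature.Computability.Complexity.Classes.P :=
  fun hmem => hH (mem_P_of_karpReducible_holds (hR hB) hmem)

/-- **THE SKELETON THEOREM.** The crux `Summit.PneNP.PneNP.Theses.StraightLineSign.PosSLPNotInP`, concluded BY
NAME (the definitional unfolding `PosSLPNotInP ≝ posSLP ∉ P` is performed by the kernel, no rewriting) from the
three DECLARED stubs — the only `sorry`s of the file — through the sorry-free composition
`posSLP_not_mem_P_of_sigs`. [cite: AllenderEtAl2009, Prop. 2.3] -/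
theorem PosSLPNotInP_of : Summit.PneNP.PneNP.Theses.StraightLineSign.PosSLPNotInP :=
  posSLP_not_mem_P_of_sigs stub_uslpGrowthBound stub_uniDegSLP_karpReducible_posSLP stub_uniDegSLP_not_mem_P

/-! ## §3 Direction records (sorry-free) -/

/-- The crux is definitionally `posSLP ∉ P` (the route inlines `slpStep`/`slpValue`). [cite: AllenderEtAl2009, §2 (PosSLP)] -/
theorem crux_iff_posSLP_not_mem_P :
    Summit.PneNP.PneNP.Theses.StraightLineSign.PosSLPNotInP ↔
      Literature.Computability.AlgebraicComplexity.posSLP ∉ Literature.Computability.Complexity.Classes.P :=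
  Iff.rfl

/-- Stubs 1–2 make Stub 3 SUFFICIENT for the crux: the transfer statement `uniDegSLP ∉ P → posSLP ∉ P`
(so Stub 3 is at least as strong as the crux; the converse is not claimed). [cite: AllenderEtAl2009, Prop. 2.3] -/
theorem transfer_of_stubs12
    (hB : let ustep : List (Polynomial ℤ) → ℕ × ℕ × ℕ → List (Polynomial ℤ) := fun vs ins => vs ++ [if ins.1 % 3 = 0 then vs.getD ins.2.1 0 + vs.getD ins.2.2 0 else if ins.1 % 3 = 1 then vs.getD ins.2.1 0 - vs.getD ins.2.2 0 else vs.getD ins.2.1 0 * vs.getD ins.2.2 0]; let upoly : List (ℕ × ℕ × ℕ) → Polynomial ℤ := fun prog => ((prog.foldl ustep [1, Polynomial.X]).getLast?).getD 0; ∀ prog : List (ℕ × ℕ × ℕ), (upoly prog).natDegree ≤ 2 ^ prog.length ∧ (∑ i ∈ (upoly prog).support, |(upoly prog).coeff i|) ≤ (2 : ℤ) ^ (2 ^ prog.length))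
    (hR : (let ustep : List (Polynomial ℤ) → ℕ × ℕ × ℕ → List (Polynomial ℤ) := fun vs ins => vs ++ [if ins.1 % 3 = 0 then vs.getD ins.2.1 0 + vs.getD ins.2.2 0 else if ins.1 % 3 = 1 then vs.getD ins.2.1 0 - vs.getD ins.2.2 0 else vs.getD ins.2.1 0 * vs.getD ins.2.2 0]; let upoly : List (ℕ × ℕ × ℕ) → Polynomial ℤ := fun prog => ((prog.foldl ustep [1, Polynomial.X]).getLast?).getD 0; ∀ prog : List (ℕ × ℕ × ℕ), (upoly prog).natDegree ≤ 2 ^ prog.length ∧ (∑ i ∈ (upoly prog).support, |(upoly prog).coeff i|) ≤ (2 : ℤ) ^ (2 ^ prog.length)) → (let ustep : List (Polynomial ℤ) → ℕ × ℕ × ℕ → List (Polynomial ℤ) := fun vs ins => vs ++ [if ins.1 % 3 = 0 then vs.getD ins.2.1 0 + vs.getD ins.2.2 0 else if ins.1 % 3 = 1 then vs.getD ins.2.1 0 - vs.getD ins.2.2 0 else vs.getD ins.2.1 0 * vs.getD ins.2.2 0]; let upoly : List (ℕ × ℕ × ℕ) → Polynomial ℤ := fun prog => ((prog.foldl ustep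 [1, Polynomial.X]).getLast?).getD 0; let uniDegSLP : Language Bool := Literature.Computability.Complexity.encodingListNatBool.toLanguage {l : List ℕ | ∃ (d : ℕ) (prog : List (ℕ × ℕ × ℕ)), l = d :: prog.flatMap (fun ins => [ins.1, ins.2.1, ins.2.2]) ∧ (upoly prog).natDegree ≤ d}; Literature.Computability.Complexity.PolyTimeKarpReducible uniDegSLP Literature.Computability.AlgebraicComplexity.posSLP)) :
    (let ustep : List (Polynomial ℤ) → ℕ × ℕ × ℕ → List (Polynomial ℤ) := fun vs ins => vs ++ [if ins.1 % 3 = 0 then vs.getD ins.2.1 0 + vs.getD ins.2.2 0 else if ins.1 % 3 = 1 then vs.getD ins.2.1 0 - vs.getD ins.2.2 0 else vs.getD ins.2.1 0 * vs.getD ins.2.2 0]; let upoly : List (ℕ × ℕ × ℕ) → Polynomial ℤ := fun prog => ((prog.foldl ustep [1, Polynomial.X]).getLast?).getD 0; let uniDegSLP : Language Bool := Literature.Computability.Complexity.encodingListNatBool.toLanguage {l : List ℕ | ∃ (d : ℕ) (prog : List (ℕ × ℕ × ℕ)), l = d :: prog.flatMap (fun ins => [ins.1, ins.2.1, ins.2.2])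 ∧ (upoly prog).natDegree ≤ d}; uniDegSLP ∉ Literature.Computability.Complexity.Classes.P) →
      Literature.Computability.AlgebraicComplexity.posSLP ∉ Literature.Computability.Complexity.Classes.P :=
  fun hH => posSLP_not_mem_P_of_sigs hB hR hH

end Summit.PneNP.PneNP.Cruxes.PosSLPNotInP.Birth
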